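/-
Copyright (c) 2026 the pub-hodgecm-mathlib formalisation cell (harness21).  Prover seat hodgecm-mathlib-LH4-p09 (g3), req620 Track A «(D-RAM) FOUR-FRAME» squad
(unit U3_Laws, κ-STAGE B brick κB-G «GLUED-STRATA κ-SOCKETS», dealer LH4-plan (g11) WORD #32 (3); letter `F0/P3c/LH4/LH4-p09/g3/LETTER-kappaBG-RHS.v1.LH4p09g3.md` §5 «=»
LH4-p05 (g3) 2026-09-04T01:37:11Z).  FILE κG-C2 — THE SOCKET.  2026-09-04.
-/
import Summits.HodgeConjecture.HodgeConjecture.Theorems.F0P3cDyRamDiagonalKappaGluedDecomposition   -- κG-C1 (this seat): the orbit decomposition of the κ-census; stable reps by regime; brings ★ κG-A1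
import Summits.HodgeConjecture.HodgeConjecture.Theorems.F0P3cDyRamDiagonalKappaGluedClass           -- κG-A2 (this seat): `kappaCount_zero_latt_glued_rep` (κ of the glued class)
import Summits.HodgeConjecture.HodgeConjecture.Theorems.F0P3cDyRamDiagonalKappaGluedClassSums       -- κG-B2 (this seat): the character sums over the fixed classes; brings κG-B1
import Summits.HodgeConjecture.HodgeConjecture.Theorems.F0P3cDyRamDiagonalGluedTubeContribution     -- ★ F2 (LH4-p08 (g2)): `glued_eq_empty_of_offFoot`, `glued_eq_empty_of_depth_lt`
import Summits.HodgeConjecture.HodgeConjecture.Theorems.F0P3cDyRamDiagonalGluedStratum              -- ★ F1 p856131 (F0P3-p01 (g31)): `stratum_G1_eq`, `stratum_G1_eq_empty_of_odd`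
import Summits.HodgeConjecture.HodgeConjecture.Theorems.F0P3cDyRamGlueUnitRationalityDepth          -- ★ p856146 bridge (LH4-p08 (g2)): `exists_fixed_v_add_glueUnit_le_iff`
import Literature.NumberTheory.LocalFields.WildQuadraticDatumTraceBound                           -- ★ (LH4-p07 (g3)): `trace_bound_of_isRamifiedQuadraticDatum`
import Literature.NumberTheory.Automorphic.UnitaryThreeFourFrameFixedCosetDictionary               -- ★ `v_eq_one_of_mul_map_eq_one`
import HarnessLib

/-!
# Crux `H413`, line LH4 «(D-RAM) FOUR-FRAME» road — unit U3_Laws (iii), κ-STAGE B brick κB-G, FILE κG-C2 — THE SOCKET «GLUED-STRATA κ-CENSUS»: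
# `∑ᶠ_{M ∈ stratum (2ρ,2ρ+s,2ρ+s)} κ_i(M)·w(M) = [tube]_i + [glue]_i` at vertex type `0`

Cell `hodgecm-mathlib` (D-0151), FLOOR 0, crux item H413 = `stmt-HodgeConjecture-24833`; lane `--supports stmt-HodgeConjecture-24833 --as helper` (count-neutral).  THEOREMS ONLY (no `def`,
no instance, no notation, no `sorry`, default heartbeats).  LAW-FREE: the κ-twin of ★ `F0P3cDyRamDiagonalGluedSocket.finsum_stabiliserWeight_hasAxis_G1` (the MS socket `stub_B56_G1`),
with LH4-p05 (g3)'s κ-Stage-B weight `kappaCount σ ϖ 0 i M · stabiliserWeight σ M` (★ Fκ1 p856497), letters of `LETTER-kappaBG-RHS.v1` §5 («=» p05 01:37:11Z), `[CompleteSpace K]`.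
THE VALUES (`s = 2t`, `ω = normSign σ`, `q = #𝓀`, conductor `d`; letter §2–§3, LH4-p05 κ-oracle 01:33:47Z ∕ 01:37:11Z «=» on (7,3,3), (9,3,3)):
* TUBE (`2ρ ≤ min(n₂,n₃)`, `2ρ+s ≤ n₁`): slot `0`: `ω(−1)·q^{2ρ+t−1}·((q−1)·[2d ≤ s] − [s+2 = 2d])`; slots `1, 2`: `0`.
* GLUE (`n₂ = n₃ = m`, `n₁ = m+s`, `m < 2ρ`, `2ρ−m ≤ m−d+1`; `f₀` any fixed element with `|f₀ + (β−1)∕(α−1)| ≤ |ϖ|^{2ρ+s−m}`, `B = t + ⌈(2ρ−m)∕2⌉`, mass `q^{2ρ+t−⌈(2ρ−m)∕2⌉}`):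
  slot `0`: `[d ≤ B]·ω(−1)ω(1+f₀)`; slot `1`: `[d ≤ ⌈(2ρ−m)∕2⌉]·ω(−1)ω(f₀)ω(1+f₀)`; slot `2`: `[d ≤ ⌈(2ρ−m)∕2⌉]·ω(f₀)` — times the mass.
THE PROOF.  ★ F1 turns the stratum into the glued family (`s` odd: empty); κG-C1 decomposes its κ-census as `q^{2ρ+t−⌈ρ∕2⌉} · Σ_{g ∈ R, T·latt V₀(g) = latt V₀(g)} κ_i(latt V₀(g))` over the
class representatives `R` (★ (iv-c), `#R = (q−1)q^{⌈ρ∕2⌉−1}`); κG-A2 evaluates `κ_i(latt V₀(g))`; κG-C1 §3 identifies the stable representatives (TUBE: all; FOOT: the sub-ball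
`|g − f₀| ≤ |ϖ|^{2ρ+s−m}`; off the foot ∕ below `ρ` ∕ beyond the glue-unit depth: none — ★ F2, ★ bridge); κG-B2 sums the signs.
* HEAD **`finsum_kappaCount_mul_stabiliserWeight_hasAxis_G1`**.
HONEST LABEL.  Count-neutral; nothing printed is asserted; (KMS)∕(KSS) stay PROVER TARGETS (empirical census laws in diagonal-model currency); `HC_CM` is proved only modulo the 7 printed
citations (2 remaining named inputs: hLiu418 = `stmt-HodgeConjecture-24832`, h413 = `stmt-HodgeConjecture-24833`) until rung 0 closes.

## References
* [Kottwitz1986BaseChangeUnits] R. E. Kottwitz, *Base change for unit elements of Hecke algebras*, Compositio Math. 60 (1986), §1 pp. 240–241 (κ-orbital integrals of units as signed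
  fixed-lattice counts).
* [LanglandsShelstad1987] R. P. Langlands, D. Shelstad, *On the definition of transfer factors*, Math. Ann. 278 (1987), §3.
* [Rogawski1990] J. D. Rogawski, *Automorphic Representations of Unitary Groups in Three Variables*, Ann. of Math. Stud. 123 (1990), §4.9 Prop. 4.9.1 (a) p. 55.
* [Serre1979] J.-P. Serre, *Local Fields*, GTM 67 (1979), Ch. V §3 Prop. 5, Cor. 3.
-/

set_option autoImplicit false

noncomputable section

namespace Summit.HodgeConjecture.HodgeConjecture.Cruxes.H413.F0P3cDyRamDiagonalKappaGluedSocket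

open Matrix WithZero
open Literature.NumberTheory.Automorphic Literature.NumberTheory.Automorphic.HermitianLattice
open Literature.NumberTheory.Automorphic.UnitaryLatticeTree Literature.NumberTheory.Automorphic.UnitaryThreeFourFrame
open Literature.NumberTheory.LocalFields.WildQuadraticDatum
open Summit.HodgeConjecture.HodgeConjecture.Cruxes.H413.F0P3cDyRamDiagonalTorusDefs
open Summit.HodgeConjecture.HodgeConjecture.Cruxes.H413.F0P3cDyRamDiagonalStrataDefs
open Summit.HodgeConjecture.HodgeConjecture.Cruxes.H413.F0P3cDyRamDiagonalKappaCountDefs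
open Summit.HodgeConjecture.HodgeConjecture.Cruxes.H413.F0P3cDyRamDiagonalKappaGluedDecomposition
open Summit.HodgeConjecture.HodgeConjecture.Cruxes.H413.F0P3cDyRamDiagonalKappaGluedClass (kappaCount_zero_latt_glued_rep)
open Summit.HodgeConjecture.HodgeConjecture.Cruxes.H413.F0P3cDyRamDiagonalKappaGluedClassSums
open Summit.HodgeConjecture.HodgeConjecture.Cruxes.H413.F0P3cDyRamDiagonalFixedClassSystems
open Summit.HodgeConjecture.HodgeConjecture.Cruxes.H413.F0P3cDyRamDiagonalGluedStabiliserIndex (ne_zero_and_v_lt_one_of_v_eq_exp)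
open Summit.HodgeConjecture.HodgeConjecture.Cruxes.H413.F0P3cDyRamDiagonalGluedStratum (stratum_G1_eq stratum_G1_eq_empty_of_odd)
open Summit.HodgeConjecture.HodgeConjecture.Cruxes.H413.F0P3cDyRamDiagonalGluedTubeContribution (glued_eq_empty_of_offFoot glued_eq_empty_of_depth_lt)
open Summit.HodgeConjecture.HodgeConjecture.Cruxes.H413.F0P3cDyRamDiagonalGluedTorusOrbits (exists_gl_coe_eq_glued)
open Summit.HodgeConjecture.HodgeConjecture.Cruxes.H413.F0P3cDyRamDiagonalGluedClassRepresentatives (exists_fixed_class_representatives)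
open Summit.HodgeConjecture.HodgeConjecture.Cruxes.H413.F0P3cDyRamGlueUnitRationalityDepth (exists_fixed_v_add_glueUnit_le_iff)
open scoped Valued WithZero Matrix MatrixGroups

section Socket

variable {K : Type} [Field K] [Valued K ℤᵐ⁰] [CompleteSpace K] [Fintype 𝓀[K]] {σ : K →+* K} {ϖ : K} {d t : ℕ} {α β : K} {N₀ n₁ n₂ n₃ : ℕ}
  {T : GL (Fin 3) K}

/-! ## §1  The per-class sums, slot by slot -/

/-- **THE CLASS SUM OVER THE WHOLE LEVEL (TUBE)**, slot by slot: with `R` a complete irredundant system of the fixed elements of valuation `|ϖ|^{2t}` modulo `𝔭^{ρ+2t}` of size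
`(q−1)q^{⌈ρ∕2⌉−1}`: `Σ_R κ_0 = ω(−1)·((q−1)q^{⌈ρ∕2⌉−1}·[d ≤ t] − q^{⌈ρ∕2⌉−1}·[t+1 = d])`, `Σ_R κ_1 = Σ_R κ_2 = 0` (κG-A2 values, κG-B2 sums).
[cite: Kottwitz1986BaseChangeUnits, §1 pp. 240–241] [cite: LanglandsShelstad1987, §3] [cite: Serre1979, Ch. V §3 Prop. 5, Cor. 3] -/
theorem sum_kappaCount_glued_rep_level (hD : IsRamifiedQuadraticDatum σ ϖ d t) (h2 : Valued.v (2 : K) < 1) {ρ t' : ℕ} (hρ : 1 ≤ ρ) (ht' : 1 ≤ t')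
    (R : Finset K) (hR1 : ∀ g ∈ R, σ g = g ∧ Valued.v g = Valued.v ϖ ^ (2 * t'))
    (hR2 : ∀ f : K, σ f = f → Valued.v f = Valued.v ϖ ^ (2 * t') → ∃ g ∈ R, Valued.v (f - g) ≤ Valued.v ϖ ^ (ρ + 2 * t'))
    (hR3 : ∀ g ∈ R, ∀ g' ∈ R, Valued.v (g - g') ≤ Valued.v ϖ ^ (ρ + 2 * t') → g = g') (hRcard : R.card = (Nat.card 𝓀[K] - 1) * Nat.card 𝓀[K] ^ ((ρ + 1) / 2 - 1))
    (V₀ : K → GL (Fin 3) K) (hV₀ : ∀ g, (V₀ g : Matrix (Fin 3) (Fin 3) K) = !![1, 0, 0; 1, ϖ ^ ρ, 0; 1 * 1 + g, ϖ ^ ρ * 1, ϖ ^ (2 * ρ + 2 * t')]) (i : Fin 3) :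
    ∑ g ∈ R, (kappaCount σ ϖ 0 i (latt (V₀ g : Matrix (Fin 3) (Fin 3) K)) : ℚ) =
      (![(normSign σ (-1 : K) : ℚ) * ((if d ≤ t' then ((Nat.card 𝓀[K] : ℚ) - 1) * (Nat.card 𝓀[K] : ℚ) ^ ((ρ + 1) / 2 - 1) else 0) -
          (if t' + 1 = d then (Nat.card 𝓀[K] : ℚ) ^ ((ρ + 1) / 2 - 1) else 0)), 0, 0] : Fin 3 → ℚ) i := by
  have hκ : ∀ g ∈ R, kappaCount σ ϖ 0 i (latt (V₀ g : Matrix (Fin 3) (Fin 3) K)) =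
      (![if 2 * d ≤ ρ + 2 * t' + 1 then normSign σ (-1) * normSign σ (1 + g) else 0,
         if 2 * d ≤ ρ + 1 then normSign σ (-1) * normSign σ g * normSign σ (1 + g) else 0,
         if 2 * d ≤ ρ + 1 then normSign σ g else 0] : Fin 3 → ℤ) i :=
    fun g hg => kappaCount_zero_latt_glued_rep hD h2 hρ ht' (hR1 g hg).1 (hR1 g hg).2 (V₀ g) (hV₀ g) i
  rw [Finset.sum_congr rfl fun g hg => by rw [hκ g hg]]
  -- the level set is stable under every fixed unit
  have hA : ∀ g ∈ ({g : K | σ g = g ∧ Valued.v g = Valued.v ϖ ^ (2 * t')} : Set K), σ g = g ∧ Valued.v g = Valued.v ϖ ^ (2 * t') := fun g hg => hg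
  have hAst : ∀ g ∈ ({g : K | σ g = g ∧ Valued.v g = Valued.v ϖ ^ (2 * t')} : Set K), ∀ n : K, σ n = n → Valued.v n = 1 →
      Valued.v (n - 1) ≤ Valued.v ϖ ^ (2 * (d - 1)) → n * g ∈ ({g : K | σ g = g ∧ Valued.v g = Valued.v ϖ ^ (2 * t')} : Set K) :=
    fun g hg n hσn hn1 _ => ⟨by rw [map_mul, hσn, hg.1], by rw [map_mul, hn1, one_mul, hg.2]⟩
  have hR1' : ∀ g ∈ R, g ∈ ({g : K | σ g = g ∧ Valued.v g = Valued.v ϖ ^ (2 * t')} : Set K) := hR1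
  have hR2' : ∀ f ∈ ({g : K | σ g = g ∧ Valued.v g = Valued.v ϖ ^ (2 * t')} : Set K), ∃ g ∈ R, Valued.v (f - g) ≤ Valued.v ϖ ^ (ρ + 2 * t') :=
    fun f hf => hR2 f hf.1 hf.2
  fin_cases i
  · -- slot 0
    simp only [Fin.zero_eta, Fin.isValue, Matrix.cons_val_zero]
    by_cases hW : 2 * d ≤ ρ + 2 * t' + 1
    · simp only [if_pos hW, Int.cast_mul, ← Finset.mul_sum]
      rw [← Int.cast_sum]
      congr 1
      rcases Nat.lt_trichotomy (t' + 1) d with hlt | heq | hgt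
      · -- dead below the boundary
        rw [if_neg (by omega), if_neg (by omega), sub_zero,
          sum_normSign_one_add_eq_zero hD h2 ht' hW hA (fun g hg n hσn hn1 hn => ?_) R hR1' hR2' hR3, Int.cast_zero]
        -- stability of the level under `g ↦ n(1+g) − 1` needs `|n − 1| < |g|`, i.e. `t′ + 2 ≤ d`
        have hϖ := hD.2.2.1
        obtain ⟨hϖ0, hϖ1⟩ := ne_zero_and_v_lt_one_of_v_eq_exp hϖ
        refine ⟨by rw [map_sub, map_mul, map_add, map_one, hσn, hg.1], ?_⟩
        rw [show n * (1 + g) - 1 = n * g + (n - 1) by ring]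
        have hlt' : Valued.v (n - 1) < Valued.v (n * g) := by
          rw [map_mul, hn1, one_mul, hg.2]
          exact hn.trans_lt (pow_lt_pow_right_of_lt_one₀ ((Valuation.pos_iff _).2 hϖ0) hϖ1 (by omega))
        rw [Valuation.map_add_eq_of_lt_left _ hlt', map_mul, hn1, one_mul, hg.2]
      · -- the boundary
        rw [if_neg (by omega), if_pos heq, zero_sub, sum_normSign_one_add_boundary hD h2 hρ ht' heq R hR1 hR2 hR3]
        push_cast; ring
      · -- deep
        rw [if_pos (by omega), if_neg (by omega), sub_zero, sum_normSign_one_add_eq_card_of_le hD (by omega) R hR1, hRcard]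
        have hq : 1 ≤ Nat.card 𝓀[K] := Nat.one_le_iff_ne_zero.2 Nat.card_pos.ne'
        push_cast [Nat.cast_sub hq]; ring
    · simp only [if_neg hW, Int.cast_zero, Finset.sum_const_zero]
      rw [if_neg (by omega), if_neg (by omega)]; ring
  · -- slot 1
    simp only [Fin.mk_one, Fin.isValue, Matrix.cons_val_one, Matrix.cons_val_zero]
    by_cases hW : 2 * d ≤ ρ + 1
    · simp only [if_pos hW]
      have e : ∑ x ∈ R, ((normSign σ (-1) * normSign σ x * normSign σ (1 + x) : ℤ) : ℚ) =
          (normSign σ (-1) : ℚ) * ((∑ x ∈ R, normSign σ x * normSign σ (1 + x) : ℤ) : ℚ) := by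
        push_cast
        rw [Finset.mul_sum]
        exact Finset.sum_congr rfl fun x _ => by ring
      rw [e, sum_normSign_mul_normSign_one_add_eq_zero hD h2 hW ht' hA hAst R hR1' hR2' hR3, Int.cast_zero, mul_zero]
    · simp only [if_neg hW, Int.cast_zero, Finset.sum_const_zero]
  · -- slot 2
    simp only [Fin.reduceFinMk, Matrix.cons_val_two, Matrix.tail_cons, Matrix.head_cons]
    by_cases hW : 2 * d ≤ ρ + 1
    · simp only [if_pos hW]
      norm_cast
      exact sum_normSign_eq_zero hD h2 hW hA hAst R hR1' hR2' hR3
    · simp only [if_neg hW, Int.cast_zero, Finset.sum_const_zero]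

/-- **THE CLASS SUM OVER A GLUE SUB-BALL** `{g = σg : |g − c₀| ≤ |ϖ|^k}` (`|c₀| = |ϖ|^{2t}`, `2t < k ≤ ρ+2t`), slot by slot, with its class count `q^{⌈(ρ+2t)∕2⌉ − ⌈k∕2⌉}`:
`Σ_S κ_0 = [2d ≤ k+1]·ω(−1)ω(1+c₀)·#S`, `Σ_S κ_1 = [2d+2t ≤ k+1]·ω(−1)ω(c₀)ω(1+c₀)·#S`, `Σ_S κ_2 = [2d+2t ≤ k+1]·ω(c₀)·#S` (κG-A2 values, κG-B2 §2–§4).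
[cite: Kottwitz1986BaseChangeUnits, §1 pp. 240–241] [cite: LanglandsShelstad1987, §3] [cite: Serre1979, Ch. V §3 Prop. 5, Cor. 3] -/
theorem sum_kappaCount_glued_rep_subBall (hD : IsRamifiedQuadraticDatum σ ϖ d t) (h2 : Valued.v (2 : K) < 1) {ρ t' k : ℕ} (hρ : 1 ≤ ρ) (ht' : 1 ≤ t')
    (hk : 2 * t' < k) (hkρ : k ≤ ρ + 2 * t') {c₀ : K} (hσc₀ : σ c₀ = c₀) (hc₀ : Valued.v c₀ = Valued.v ϖ ^ (2 * t')) (S : Finset K)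
    (hS1 : ∀ g ∈ S, g ∈ {g : K | σ g = g ∧ Valued.v (g - c₀) ≤ Valued.v ϖ ^ k})
    (hS2 : ∀ f ∈ {g : K | σ g = g ∧ Valued.v (g - c₀) ≤ Valued.v ϖ ^ k}, ∃ g ∈ S, Valued.v (f - g) ≤ Valued.v ϖ ^ (ρ + 2 * t'))
    (hS3 : ∀ g ∈ S, ∀ g' ∈ S, Valued.v (g - g') ≤ Valued.v ϖ ^ (ρ + 2 * t') → g = g')
    (V₀ : K → GL (Fin 3) K) (hV₀ : ∀ g, (V₀ g : Matrix (Fin 3) (Fin 3) K) = !![1, 0, 0; 1, ϖ ^ ρ, 0; 1 * 1 + g, ϖ ^ ρ * 1, ϖ ^ (2 * ρ + 2 * t')]) (i : Fin 3) :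
    ∑ g ∈ S, (kappaCount σ ϖ 0 i (latt (V₀ g : Matrix (Fin 3) (Fin 3) K)) : ℚ) =
      (![if 2 * d ≤ k + 1 then (normSign σ (-1 : K) : ℚ) * normSign σ (1 + c₀) else 0,
         if 2 * d + 2 * t' ≤ k + 1 then (normSign σ (-1 : K) : ℚ) * normSign σ c₀ * normSign σ (1 + c₀) else 0,
         if 2 * d + 2 * t' ≤ k + 1 then (normSign σ c₀ : ℚ) else 0] : Fin 3 → ℚ) i *
        (Nat.card 𝓀[K] : ℚ) ^ ((ρ + 2 * t' + 1) / 2 - (k + 1) / 2) := by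
  have hlev : ∀ g ∈ ({g : K | σ g = g ∧ Valued.v (g - c₀) ≤ Valued.v ϖ ^ k} : Set K), σ g = g ∧ Valued.v g = Valued.v ϖ ^ (2 * t') :=
    fun g hg => level_of_mem_subBall hD hk hc₀ hg
  have hκ : ∀ g ∈ S, kappaCount σ ϖ 0 i (latt (V₀ g : Matrix (Fin 3) (Fin 3) K)) =
      (![if 2 * d ≤ ρ + 2 * t' + 1 then normSign σ (-1) * normSign σ (1 + g) else 0,
         if 2 * d ≤ ρ + 1 then normSign σ (-1) * normSign σ g * normSign σ (1 + g) else 0,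
         if 2 * d ≤ ρ + 1 then normSign σ g else 0] : Fin 3 → ℤ) i :=
    fun g hg => kappaCount_zero_latt_glued_rep hD h2 hρ ht' (hlev g (hS1 g hg)).1 (hlev g (hS1 g hg)).2 (V₀ g) (hV₀ g) i
  have hcard : (S.card : ℚ) = (Nat.card 𝓀[K] : ℚ) ^ ((ρ + 2 * t' + 1) / 2 - (k + 1) / 2) := by
    rw [card_repr_subBall hD hkρ hσc₀ S hS1 hS2 hS3]; push_cast; rfl
  rw [Finset.sum_congr rfl fun g hg => by rw [hκ g hg]]
  fin_cases i
  · -- slot 0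
    simp only [Fin.zero_eta, Fin.isValue, Matrix.cons_val_zero]
    by_cases hW : 2 * d ≤ ρ + 2 * t' + 1
    · simp only [if_pos hW, Int.cast_mul, ← Finset.mul_sum]
      rw [← Int.cast_sum]
      by_cases hB : 2 * d ≤ k + 1
      · rw [if_pos hB, sum_normSign_one_add_subBall_eq hD ht' (by omega) hσc₀ hc₀ S hS1, ← hcard]; push_cast; ring
      · rw [if_neg hB, zero_mul, sum_normSign_one_add_eq_zero hD h2 ht' hW hlev (fun g hg n hσn hn1 hn => twist_mem_subBall hD (by omega) hc₀ hg hσn hn1 hn)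
          S hS1 hS2 hS3, Int.cast_zero, mul_zero]
    · simp only [if_neg hW, Int.cast_zero, Finset.sum_const_zero]
      rw [if_neg (by omega), zero_mul]
  · -- slot 1
    simp only [Fin.mk_one, Fin.isValue, Matrix.cons_val_one, Matrix.cons_val_zero]
    by_cases hW : 2 * d ≤ ρ + 1
    · simp only [if_pos hW]
      have e : ∑ x ∈ S, ((normSign σ (-1) * normSign σ x * normSign σ (1 + x) : ℤ) : ℚ) =
          (normSign σ (-1) : ℚ) * ((∑ x ∈ S, normSign σ x * normSign σ (1 + x) : ℤ) : ℚ) := by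
        push_cast
        rw [Finset.mul_sum]
        exact Finset.sum_congr rfl fun x _ => by ring
      rw [e]
      by_cases hB : 2 * d + 2 * t' ≤ k + 1
      · rw [if_pos hB, (sum_normSign_subBall_eq hD ht' (by omega) hσc₀ hc₀ S hS1).2, ← hcard]; push_cast; ring
      · rw [if_neg hB, zero_mul, sum_normSign_mul_normSign_one_add_eq_zero hD h2 hW ht' hlev
          (fun g hg n hσn hn1 hn => mul_mem_subBall hD (by omega) hc₀ hg hσn hn1 hn) S hS1 hS2 hS3, Int.cast_zero, mul_zero]
    · simp only [if_neg hW, Int.cast_zero, Finset.sum_const_zero]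
      rw [if_neg (by omega), zero_mul]
  · -- slot 2
    simp only [Fin.reduceFinMk, Matrix.cons_val_two, Matrix.tail_cons, Matrix.head_cons]
    by_cases hW : 2 * d ≤ ρ + 1
    · simp only [if_pos hW]
      rw [← Int.cast_sum]
      by_cases hB : 2 * d + 2 * t' ≤ k + 1
      · rw [if_pos hB, (sum_normSign_subBall_eq hD ht' (by omega) hσc₀ hc₀ S hS1).1, ← hcard]; push_cast; ring
      · rw [if_neg hB, zero_mul, sum_normSign_eq_zero hD h2 hW hlev (fun g hg n hσn hn1 hn => mul_mem_subBall hD (by omega) hc₀ hg hσn hn1 hn) S hS1 hS2 hS3,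
          Int.cast_zero]
    · simp only [if_neg hW, Int.cast_zero, Finset.sum_const_zero]
      rw [if_neg (by omega), zero_mul]

/-! ## §2  HEAD — the socket -/

/-- **κB-G «GLUED-STRATA κ-SOCKET» AT VERTEX TYPE `0`** (letter §5, «=» LH4-p05 (g3)): for the law's element datum `(α, β; n₁, n₂, n₃)` at threshold `N₀ ≥ d`, `T = diag(α, β, 1)`,
the dyadic fence `|2| < 1` on a complete `K` with finite residue field, axis `(2ρ, 2ρ+s, 2ρ+s)` with `ρ, s ≥ 1`, slot `i`, and ANY fixed `f₀` which, ON THE GLUE REGIME, approximates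
`−(β−1)∕(α−1)` to depth `2ρ+s−n₂` (off the glue regime `f₀ := 0` serves):  `Σᶠ_{M ∈ stratum} κ_i(M)·w(M) = [TUBE]_i + [GLUE]_i` with
TUBE (`2∣s`, `2ρ ≤ min(n₂,n₃)`, `2ρ+s ≤ n₁`) = `(ω(−1)·q^{2ρ+s∕2−1}·((q−1)[2d ≤ s] − [s+2 = 2d]), 0, 0)_i` and GLUE (`2∣s`, `n₂ = n₃`, `n₁ = n₂+s`, `n₂ < 2ρ`, `2ρ−n₂ ≤ n₂−d+1`) =
`([2d ≤ s + 2⌈(2ρ−n₂)∕2⌉]·ω(−1)ω(1+f₀), [d ≤ ⌈(2ρ−n₂)∕2⌉]·ω(−1)ω(f₀)ω(1+f₀), [d ≤ ⌈(2ρ−n₂)∕2⌉]·ω(f₀))_i · q^{2ρ+s∕2−⌈(2ρ−n₂)∕2⌉}` (`ω = normSign σ`, `q = #𝓀`).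
[cite: Kottwitz1986BaseChangeUnits, §1 pp. 240–241] [cite: LanglandsShelstad1987, §3] [cite: Rogawski1990, §4.9 Prop. 4.9.1 (a) p. 55] [cite: Serre1979, Ch. V §3 Prop. 5, Cor. 3] -/
theorem finsum_kappaCount_mul_stabiliserWeight_hasAxis_G1 (hD : IsRamifiedQuadraticDatum σ ϖ d t) (h2 : Valued.v (2 : K) < 1)
    (hE : IsElementDatum σ ϖ N₀ α β n₁ n₂ n₃) (hN₀ : d ≤ N₀) (hT : (T : Matrix (Fin 3) (Fin 3) K) = Matrix.diagonal ![α, β, 1])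
    (ρ s : ℕ) (hρ : 1 ≤ ρ) (hs : 1 ≤ s) (i : Fin 3) (f₀ : K) (hf₀ : σ f₀ = f₀)
    (hglue : 2 ∣ s → n₂ = n₃ → n₁ = n₂ + s → n₂ < 2 * ρ → 2 * ρ - n₂ ≤ n₂ - d + 1 → Valued.v (f₀ + (β - 1) / (α - 1)) ≤ Valued.v ϖ ^ (2 * ρ + s - n₂)) :
    ∑ᶠ M ∈ stratum σ ϖ T ![2 * ρ, 2 * ρ + s, 2 * ρ + s], (kappaCount σ ϖ 0 i M : ℚ) * stabiliserWeight σ M =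
      (if 2 ∣ s ∧ 2 * ρ ≤ min n₂ n₃ ∧ 2 * ρ + s ≤ n₁ then
          (![(normSign σ (-1 : K) : ℚ) * (Fintype.card 𝓀[K] : ℚ) ^ (2 * ρ + s / 2 - 1) *
              ((if 2 * d ≤ s then (Fintype.card 𝓀[K] : ℚ) - 1 else 0) - (if s + 2 = 2 * d then 1 else 0)), 0, 0] : Fin 3 → ℚ) i
        else 0) +
      (if 2 ∣ s ∧ n₂ = n₃ ∧ n₁ = n₂ + s ∧ n₂ < 2 * ρ ∧ 2 * ρ - n₂ ≤ n₂ - d + 1 then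
          (![if 2 * d ≤ s + 2 * ((2 * ρ - n₂ + 1) / 2) then (normSign σ (-1 : K) : ℚ) * normSign σ (1 + f₀) else 0,
             if d ≤ (2 * ρ - n₂ + 1) / 2 then (normSign σ (-1 : K) : ℚ) * normSign σ f₀ * normSign σ (1 + f₀) else 0,
             if d ≤ (2 * ρ - n₂ + 1) / 2 then (normSign σ f₀ : ℚ) else 0] : Fin 3 → ℚ) i *
            (Fintype.card 𝓀[K] : ℚ) ^ (2 * ρ + s / 2 - (2 * ρ - n₂ + 1) / 2)
        else 0) := by
  classical
  have hTr := trace_bound_of_isRamifiedQuadraticDatum hD h2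
  obtain ⟨hσ, hvσ, hϖ, hfix, hdd, h1d, -⟩ := id hD
  obtain ⟨hαn, hβn, -, hα1, hβ1, h₁, h₂, h₃, hN1, hN2, hN3⟩ := hE
  have hα := UnitaryThreeFourFrame.v_eq_one_of_mul_map_eq_one hvσ hαn
  have hβ := UnitaryThreeFourFrame.v_eq_one_of_mul_map_eq_one hvσ hβn
  have h₃' : Valued.v (β - α) = Valued.v ϖ ^ n₃ := by rw [Valuation.map_sub_swap, h₃]
  obtain ⟨hϖ0, hϖ1⟩ := ne_zero_and_v_lt_one_of_v_eq_exp hϖ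
  have hvϖ : 0 < Valued.v ϖ := (Valuation.pos_iff _).2 hϖ0
  obtain ⟨hi1, hi2, -⟩ := isoceles_depths hϖ h₁ h₂ h₃
  have hq1 : 1 < Nat.card 𝓀[K] := Finite.one_lt_card
  rw [← Nat.card_eq_fintype_card]
  by_cases hpar : 2 ∣ s
  · obtain ⟨t', rfl⟩ := hpar
    have ht' : 1 ≤ t' := by omega
    rw [show 2 * t' / 2 = t' by omega, stratum_G1_eq hvσ hfix hϖ T hρ hs]
    -- the class representatives and the reference frames
    obtain ⟨R₀, hR₀fin, hR₀card, hR1, hR2, hR3⟩ := exists_fixed_class_representatives hσ hvσ hfix hϖ hdd ρ t' hρ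
    set R : Finset K := hR₀fin.toFinset with hRdef
    have hmemR : ∀ g, g ∈ R ↔ g ∈ R₀ := fun g => Set.Finite.mem_toFinset hR₀fin
    have hRcard : R.card = (Nat.card 𝓀[K] - 1) * Nat.card 𝓀[K] ^ ((ρ + 1) / 2 - 1) := by rw [hRdef, ← Set.ncard_eq_toFinset_card R₀ hR₀fin]; exact hR₀card
    have hR1' : ∀ g ∈ R, σ g = g ∧ Valued.v g = Valued.v ϖ ^ (2 * t') := fun g hg => hR1 g ((hmemR g).1 hg)
    have hR2' : ∀ f : K, σ f = f → Valued.v f = Valued.v ϖ ^ (2 * t') → ∃ g ∈ R, Valued.v (f - g) ≤ Valued.v ϖ ^ (ρ + 2 * t') :=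
      fun f hσf hvf => by obtain ⟨g, hg, h⟩ := hR2 f hσf hvf; exact ⟨g, (hmemR g).2 hg, h⟩
    have hR3' : ∀ g ∈ R, ∀ g' ∈ R, Valued.v (g - g') ≤ Valued.v ϖ ^ (ρ + 2 * t') → g = g' :=
      fun g hg g' hg' h => hR3 g ((hmemR g).1 hg) g' ((hmemR g').1 hg') h
    choose V₀ hV₀ using fun g : K => exists_gl_coe_eq_glued (1 : K) 1 g (pow_ne_zero ρ hϖ0) (pow_ne_zero (2 * ρ + 2 * t') hϖ0)
    by_cases htube : 2 * ρ + 2 * t' ≤ n₁ ∧ 2 * ρ ≤ n₂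
    · -- THE TUBE: every representative is stable
      have hn₃ : 2 * ρ ≤ n₃ := le_trans (le_min (by omega) htube.2) hi1
      rw [if_pos (show 2 ∣ 2 * t' ∧ 2 * ρ ≤ min n₂ n₃ ∧ 2 * ρ + 2 * t' ≤ n₁ from ⟨dvd_mul_right 2 t', le_min htube.2 hn₃, htube.1⟩),
        if_neg (show ¬ (2 ∣ 2 * t' ∧ n₂ = n₃ ∧ n₁ = n₂ + 2 * t' ∧ n₂ < 2 * ρ ∧ 2 * ρ - n₂ ≤ n₂ - d + 1) from fun h => absurd h.2.2.2.1 (not_lt.2 htube.2)), add_zero,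
        finsum_kappaCount_mul_stabiliserWeight_glued_eq hσ hvσ hfix hϖ hdd hTr T hT ρ t' hρ ht' R hR1' hR2' hR3' V₀ hV₀ i,
        Finset.filter_true_of_mem (fun g hg => mapGL_latt_glued_rep_of_depths hϖ0 hϖ1.le hα hβ T hT h₁ h₂ h₃' htube.1 htube.2 (by omega) (hR1' g hg).2
          (V₀ g) (hV₀ g)),
        sum_kappaCount_glued_rep_level hD h2 hρ ht' R hR1' hR2' hR3' hRcard V₀ hV₀ i]
      have hq0 : (Nat.card 𝓀[K] : ℚ) ≠ 0 := by exact_mod_cast (by omega : Nat.card 𝓀[K] ≠ 0)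
      fin_cases i
      · simp only [Fin.zero_eta, Fin.isValue, Matrix.cons_val_zero]
        have hj : (ρ + 2 * t' + 1) / 2 = (ρ + 1) / 2 + t' := by
          rw [show ρ + 2 * t' + 1 = ρ + 1 + t' * 2 by ring, Nat.add_mul_div_right _ _ (by norm_num : 0 < 2)]
        have e1 : 2 * ρ + 2 * t' - (ρ + 2 * t' + 1) / 2 + ((ρ + 1) / 2 - 1) = 2 * ρ + t' - 1 := by rw [hj]; omega
        have epow : (Nat.card 𝓀[K] : ℚ) ^ (2 * ρ + t' - 1) =
            (Nat.card 𝓀[K] : ℚ) ^ (2 * ρ + 2 * t' - (ρ + 2 * t' + 1) / 2) * (Nat.card 𝓀[K] : ℚ) ^ ((ρ + 1) / 2 - 1) := by rw [← pow_add, e1]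
        by_cases hdt : d ≤ t'
        · rw [if_pos hdt, if_neg (show ¬ (t' + 1 = d) by omega), if_pos (show 2 * d ≤ 2 * t' by omega),
            if_neg (show ¬ (2 * t' + 2 = 2 * d) by omega), epow]
          ring
        · rw [if_neg hdt, if_neg (show ¬ (2 * d ≤ 2 * t') by omega)]
          by_cases hbd : t' + 1 = d
          · rw [if_pos hbd, if_pos (show 2 * t' + 2 = 2 * d by omega), epow]
            ring
          · rw [if_neg hbd, if_neg (show ¬ (2 * t' + 2 = 2 * d) by omega)]
            ring
      · simp
      · simp
    · rw [if_neg (show ¬ (2 ∣ 2 * t' ∧ 2 * ρ ≤ min n₂ n₃ ∧ 2 * ρ + 2 * t' ≤ n₁) from fun h => htube ⟨h.2.2, (le_min_iff.1 h.2.1).1⟩), zero_add]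
      by_cases hfoot : n₁ = n₂ + 2 * t'
      · -- ON THE FOOT: `n₃ = n₂ < 2ρ`
        have hn₃ : n₃ = n₂ := by
          rcases min_le_iff.1 hi1 with h | h <;> rcases min_le_iff.1 hi2 with h' | h' <;> omega
        subst hn₃
        have hm : n₃ < 2 * ρ := by
          by_contra hge
          exact htube ⟨by omega, not_lt.1 hge⟩
        rw [hfoot] at h₁
        by_cases hρm : ρ ≤ n₃
        · -- THE GLUE CANDIDATES `ρ ≤ m < 2ρ`: stable reps = the sub-ball around `−(β−1)∕(α−1)`
          have hvϖ0 : Valued.v ϖ ≠ 0 := hvϖ.ne'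
          have hg : Valued.v ((β - 1) / (α - 1)) = Valued.v ϖ ^ (2 * t') := by
            rw [map_div₀, h₁, h₂, pow_add, mul_div_cancel_left₀ _ (pow_ne_zero n₃ hvϖ0)]
          have hαd : Valued.v (α - 1) ≤ Valued.v ϖ ^ d := by rw [h₂]; exact pow_le_pow_right_of_le_one' hϖ1.le (by omega)
          have hβd : Valued.v (β - 1) ≤ Valued.v ϖ ^ d := by rw [h₁]; exact pow_le_pow_right_of_le_one' hϖ1.le (by omega)
          have hswitch := exists_fixed_v_add_glueUnit_le_iff hσ hvσ hfix hϖ hdd h1d hαn hβn hα1 hβ1 hαd hβd h₃ (by omega) hg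
            (by omega : 2 * t' ≤ 2 * ρ + 2 * t' - n₃)
          rw [finsum_kappaCount_mul_stabiliserWeight_glued_eq hσ hvσ hfix hϖ hdd hTr T hT ρ t' hρ ht' R hR1' hR2' hR3' V₀ hV₀ i,
            Finset.filter_congr (fun g hg => mapGL_latt_glued_rep_iff hϖ hα hβ T hT h₁ h₂ h₃' hρm (by omega) g (V₀ g) (hV₀ g))]
          by_cases hdepth : 2 * ρ - n₃ ≤ n₃ - d + 1
          · -- THE GLUE REGIME: `f₀` approximates the glue unit
            have hf₀' : Valued.v (f₀ + (β - 1) / (α - 1)) ≤ Valued.v ϖ ^ (2 * ρ + 2 * t' - n₃) := hglue (dvd_mul_right 2 t') rfl hfoot hm hdepth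
            rw [if_pos ⟨dvd_mul_right 2 t', rfl, hfoot, hm, hdepth⟩]
            -- `|f₀| = |ϖ|^{2t'}` and the sub-ball around `f₀`
            have hlt : Valued.v ϖ ^ (2 * ρ + 2 * t' - n₃) < Valued.v ϖ ^ (2 * t') := pow_lt_pow_right_of_lt_one₀ hvϖ hϖ1 (by omega)
            have hvf₀ : Valued.v f₀ = Valued.v ϖ ^ (2 * t') := by
              have h := Valuation.map_sub_eq_of_lt_left Valued.v (hg ▸ (by rw [show (β - 1) / (α - 1) - (-f₀) = f₀ + (β - 1) / (α - 1) by ring]; exact hf₀'.trans_lt hlt) :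
                Valued.v ((β - 1) / (α - 1) - (-f₀)) < Valued.v ((β - 1) / (α - 1)))
              rw [show (β - 1) / (α - 1) - ((β - 1) / (α - 1) - -f₀) = -f₀ by ring, Valuation.map_neg] at h
              rw [h, hg]
            -- the stable representatives form a system for the sub-ball
            set S : Finset K := R.filter (fun g => Valued.v (g + (β - 1) / (α - 1)) ≤ Valued.v ϖ ^ (2 * ρ + 2 * t' - n₃)) with hS
            have hnear : ∀ g : K, Valued.v (g + (β - 1) / (α - 1)) ≤ Valued.v ϖ ^ (2 * ρ + 2 * t' - n₃) ↔
                Valued.v (g - f₀) ≤ Valued.v ϖ ^ (2 * ρ + 2 * t' - n₃) := fun g => by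
              constructor
              · intro h
                rw [show g - f₀ = (g + (β - 1) / (α - 1)) - (f₀ + (β - 1) / (α - 1)) by ring]
                exact Valuation.map_sub_le _ h hf₀'
              · intro h
                rw [show g + (β - 1) / (α - 1) = (g - f₀) + (f₀ + (β - 1) / (α - 1)) by ring]
                exact Valuation.map_add_le _ h hf₀'
            have hS1 : ∀ g ∈ S, g ∈ {g : K | σ g = g ∧ Valued.v (g - f₀) ≤ Valued.v ϖ ^ (2 * ρ + 2 * t' - n₃)} := fun g hg => by
              obtain ⟨hgR, hge⟩ := Finset.mem_filter.1 hg
              exact ⟨(hR1' g hgR).1, (hnear g).1 hge⟩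
            have hS2 : ∀ f ∈ {g : K | σ g = g ∧ Valued.v (g - f₀) ≤ Valued.v ϖ ^ (2 * ρ + 2 * t' - n₃)},
                ∃ g ∈ S, Valued.v (f - g) ≤ Valued.v ϖ ^ (ρ + 2 * t') := by
              intro f hf
              obtain ⟨hσf, hvf⟩ := level_of_mem_subBall hD (by omega) hvf₀ hf
              obtain ⟨g, hg, hfg⟩ := hR2' f hσf hvf
              refine ⟨g, Finset.mem_filter.2 ⟨hg, (hnear g).2 ?_⟩, hfg⟩
              rw [show g - f₀ = (f - f₀) - (f - g) by ring]
              exact Valuation.map_sub_le _ hf.2 (hfg.trans (pow_le_pow_right_of_le_one' hϖ1.le (by omega)))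
            have hS3 : ∀ g ∈ S, ∀ g' ∈ S, Valued.v (g - g') ≤ Valued.v ϖ ^ (ρ + 2 * t') → g = g' :=
              fun g hg g' hg' h => hR3' g (Finset.mem_filter.1 hg).1 g' (Finset.mem_filter.1 hg').1 h
            rw [sum_kappaCount_glued_rep_subBall hD h2 hρ ht' (by omega) (by omega) hf₀ hvf₀ S hS1 hS2 hS3 V₀ hV₀ i]
            have hj : (ρ + 2 * t' + 1) / 2 = (ρ + 1) / 2 + t' := by
              rw [show ρ + 2 * t' + 1 = ρ + 1 + t' * 2 by ring, Nat.add_mul_div_right _ _ (by norm_num : 0 < 2)]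
            have hk' : (2 * ρ + 2 * t' - n₃ + 1) / 2 = (2 * ρ - n₃ + 1) / 2 + t' := by
              rw [show 2 * ρ + 2 * t' - n₃ + 1 = 2 * ρ - n₃ + 1 + t' * 2 by omega, Nat.add_mul_div_right _ _ (by norm_num : 0 < 2)]
            have hexp : 2 * ρ + 2 * t' - (ρ + 2 * t' + 1) / 2 + ((ρ + 2 * t' + 1) / 2 - (2 * ρ + 2 * t' - n₃ + 1) / 2) =
                2 * ρ + t' - (2 * ρ - n₃ + 1) / 2 := by rw [hj, hk']; omega
            rw [← mul_comm ((Nat.card 𝓀[K] : ℚ) ^ _), ← mul_assoc, ← pow_add, hexp, mul_comm]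
            congr 1
            fin_cases i
            · simp only [Fin.zero_eta, Fin.isValue, Matrix.cons_val_zero]
              exact if_congr (by omega) rfl rfl
            · simp only [Fin.mk_one, Fin.isValue, Matrix.cons_val_one, Matrix.cons_val_zero]
              exact if_congr (by omega) rfl rfl
            · simp only [Fin.reduceFinMk, Matrix.cons_val_two, Matrix.tail_cons, Matrix.head_cons]
              exact if_congr (by omega) rfl rfl
          · -- BEYOND THE GLUE-UNIT DEPTH: no representative is stable
            have hnone : ∀ g ∈ R, ¬ Valued.v (g + (β - 1) / (α - 1)) ≤ Valued.v ϖ ^ (2 * ρ + 2 * t' - n₃) := fun g hg h =>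
              hdepth (by have := hswitch.1 ⟨g, (hR1' g hg).1, h⟩; omega)
            rw [Finset.filter_false_of_mem hnone, Finset.sum_empty, mul_zero, if_neg (fun h => hdepth h.2.2.2.2)]
        · -- TOO SHALLOW: `m < ρ`
          rw [glued_eq_empty_of_depth_lt σ hϖ hα hβ T hT h₃' ρ (2 * t') (not_le.1 hρm), finsum_mem_empty,
            if_neg (fun h => by have := h.2.2.2.2; omega)]
      · -- OFF THE FOOT, BELOW THE TUBE: nothing
        rw [glued_eq_empty_of_offFoot σ hϖ0 hϖ1 hα hβ T hT h₁ h₂ ρ (2 * t') hfoot htube, finsum_mem_empty, if_neg (fun h => hfoot h.2.2.1)]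
  · -- `s` ODD: the stratum is empty
    rw [stratum_G1_eq_empty_of_odd hvσ hfix hϖ T hρ hpar, finsum_mem_empty, if_neg (fun h => hpar h.1), if_neg (fun h => hpar h.1), add_zero]

end Socket

end Summit.HodgeConjecture.HodgeConjecture.Cruxes.H413.F0P3cDyRamDiagonalKappaGluedSocket

end
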